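import Mathlib
import Summits.MatrixMultiplication.Statement
import Summits.MatrixMultiplication.MatrixMultiplication.Theorems.GraphEquationsOneOneSyzygies

/-!
# One-sided syzygies of the product matrix vanish (`GraphEquations`, M38)

Decomp-mm node «GraphEquations» (lens 5 «finite range + asymptotic regime + bridge», g38); attacked
leaf `MultiplicityReduction` (stmt-MatrixMultiplication-27806).  Target of the node, VERBATIM:
`_root_.MatrixMultiplication`.  Route-neutral (`closes` unchanged); imports no `Theses/` file.

Companion of `GraphEquationsOneOneSyzygies` (the `(1,1)`-block).  Write `φ_q = Σ_k a_{q₁k} b_{kq₂}`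
for the entries of `AB`.  A ONE-SIDED family has coefficients `α_q ∈ ℂ[A]` (polynomials of ANY
degree in the entries of `A` alone), resp. `α_q ∈ ℂ[B]`.
* `eq_zero_of_left_syzygy` — if `Σ_q α_q(A)·(AB)_q = 0` for all `A, B` then `α = 0` (ALL `n`):
  testing against `B = E_{(k,q₂)}` gives `Aᵀ·α(A) = 0` identically, i.e. `Xᵀ·M = 0` over `ℂ[X]` for
  the generic matrix `X` (`Matrix.mvPolynomialX`) and `M = (α_{q₁q₂})`; multiplying by `adj(Xᵀ)`
  gives `det X · M = 0`, and `det X ≠ 0` in the domain `ℂ[X]`.  `eq_zero_of_right_syzygy` — the same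
  for `α_q ∈ ℂ[B]` (`M·Xᵀ = 0`).
* `leftPoly_eq_zero_of_poly` / `rightPoly_eq_zero_of_poly` — bridge: the identity
  `Σ_q α_q φ_q = 0` in `ℂ[A,B,C]` with `α_q ∈ ℂ[A]` (resp. `ℂ[B]`) forces `α = 0`.
USE (NODE-g38 §2, the cubic normal form `I(W_n)_{≤3} = ℂ[u,c]_{≤1}·⟨f⟩` for `n ≥ 3`): in the
`c`-Taylor bookkeeping the syzygies `Σ_q β_q φ_q = 0` that occur have `β_q` of `u`-degree `≤ 2`;
splitting by bidegree in `(A, B)`, the `(d,0)` and `(0,d)` blocks vanish by THIS file (all `n`) and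
the `(1,1)` block is Koszul by `isKoszul_of_bilinear_syzygy` (`n ≥ 3`); so weight `3` of the normal
form holds for all `n` and weight `4` for `n ≥ 3` — exactly where the `n = 2` adjugate syzygies live.
Why strictly weaker than the summit: commutative algebra of the generic product matrix at fixed `n`;
no cost, no exponent.  No `sorry`.
-/

-- dupNamespace: forced by the nested Summit.MatrixMultiplication.MatrixMultiplication layout (D-0017)
set_option linter.dupNamespace false

noncomputable section

namespace Summit.MatrixMultiplication.MatrixMultiplication.Theorems.GraphEquations

open MvPolynomial

variable {n : ℕ}

/-- Coefficient families in the entries of ONE matrix: `α_q ∈ ℂ[X]`, `X = (x_{ij})`. -/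
abbrev OneSided (n : ℕ) : Type := Fin n × Fin n → MvPolynomial (Fin n × Fin n) ℂ

/-! ## Evaluated one-sided identities -/

/-- `Σ_q α_q(A)·(AB)_q`. -/
def leftSyzEval (α : OneSided n) (A B : Fin n × Fin n → ℂ) : ℂ :=
  ∑ q : Fin n × Fin n, eval A (α q) * prodEntry q A B

/-- `Σ_q α_q(B)·(AB)_q`. -/
def rightSyzEval (α : OneSided n) (A B : Fin n × Fin n → ℂ) : ℂ :=
  ∑ q : Fin n × Fin n, eval B (α q) * prodEntry q A B

/-- `(A·E_{(k,q₂)})_q = [q.2 = q₂]·A_{q₁ k}`. -/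
theorem prodEntry_unitMat_right (q : Fin n × Fin n) (A : Fin n × Fin n → ℂ) (k q₂ : Fin n) :
    prodEntry q A (unitMat (k, q₂)) = if q.2 = q₂ then A (q.1, k) else 0 := by
  classical
  obtain ⟨q₁, q₂'⟩ := q
  simp only [prodEntry, unitMat_apply, Prod.mk.injEq, mul_ite, mul_one, mul_zero]
  by_cases h : q₂' = q₂ <;> simp [h]

/-- `(E_{(q₁,k)}·B)_q = [q.1 = q₁]·B_{k q₂}`. -/
theorem prodEntry_unitMat_left (q : Fin n × Fin n) (B : Fin n × Fin n → ℂ) (q₁ k : Fin n) :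
    prodEntry q (unitMat (q₁, k)) B = if q.1 = q₁ then B (k, q.2) else 0 := by
  classical
  obtain ⟨q₁', q₂⟩ := q
  simp only [prodEntry, unitMat_apply, Prod.mk.injEq, ite_mul, one_mul, zero_mul]
  by_cases h : q₁' = q₁ <;> simp [h, eq_comm]

/-- Testing a left identity against `B = E_{(k,q₂)}`: `Σ_{q₁} α_{(q₁,q₂)}(A)·A_{q₁k} = 0`. -/
theorem left_column_identity {α : OneSided n} (h : ∀ A B, leftSyzEval α A B = 0)
    (A : Fin n × Fin n → ℂ) (k q₂ : Fin n) :
    ∑ q₁ : Fin n, eval A (α (q₁, q₂)) * A (q₁, k) = 0 := by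
  classical
  have h1 := h A (unitMat (k, q₂))
  simp only [leftSyzEval, prodEntry_unitMat_right, mul_ite, mul_zero] at h1
  rw [Fintype.sum_prod_type] at h1
  simpa [Finset.sum_ite_eq', Finset.sum_ite_eq] using h1

/-- Testing a right identity against `A = E_{(q₁,k)}`: `Σ_{q₂} α_{(q₁,q₂)}(B)·B_{kq₂} = 0`. -/
theorem right_row_identity {α : OneSided n} (h : ∀ A B, rightSyzEval α A B = 0)
    (B : Fin n × Fin n → ℂ) (q₁ k : Fin n) :
    ∑ q₂ : Fin n, eval B (α (q₁, q₂)) * B (k, q₂) = 0 := by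
  classical
  have h1 := h (unitMat (q₁, k)) B
  simp only [rightSyzEval, prodEntry_unitMat_left, mul_ite, mul_zero] at h1
  rw [Fintype.sum_prod_type] at h1
  simpa [Finset.sum_ite_eq', Finset.sum_ite_eq] using h1

/-! ## The generic matrix and the adjugate trick -/

/-- The coefficient matrix `M = (α_{q₁q₂})` over `ℂ[X]`. -/
def coeffMatrix (α : OneSided n) : Matrix (Fin n) (Fin n) (MvPolynomial (Fin n × Fin n) ℂ) :=
  Matrix.of fun q₁ q₂ => α (q₁, q₂)

/-- `det X · M = 0 ⇒ α = 0` (`ℂ[X]` is a domain and `det X ≠ 0`). -/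
theorem eq_zero_of_det_smul_coeffMatrix_eq_zero {α : OneSided n}
    (h : (Matrix.mvPolynomialX (Fin n) (Fin n) ℂ).det • coeffMatrix α = 0) : α = 0 := by
  funext q
  obtain ⟨q₁, q₂⟩ := q
  have h1 := congr_fun (congr_fun h q₁) q₂
  simp only [Matrix.smul_apply, coeffMatrix, Matrix.of_apply, smul_eq_mul, Matrix.zero_apply,
    mul_eq_zero] at h1
  exact h1.resolve_left (Matrix.det_mvPolynomialX_ne_zero (Fin n) ℂ)

/-- **Left one-sided syzygies vanish**: `Σ_q α_q(A)·(AB)_q ≡ 0` with `α_q ∈ ℂ[A]` forces `α = 0`. -/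
theorem eq_zero_of_left_syzygy {α : OneSided n} (h : ∀ A B, leftSyzEval α A B = 0) : α = 0 := by
  classical
  -- `Xᵀ · M = 0` over `ℂ[X]`
  have hXM : (Matrix.mvPolynomialX (Fin n) (Fin n) ℂ).transpose * coeffMatrix α = 0 := by
    refine Matrix.ext fun k q₂ => ?_
    apply MvPolynomial.funext
    intro A
    simp only [Matrix.mul_apply, Matrix.transpose_apply, Matrix.mvPolynomialX_apply, coeffMatrix,
      Matrix.of_apply, Matrix.zero_apply, map_sum, map_mul, eval_X, map_zero]
    simpa [mul_comm] using left_column_identity h A k q₂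
  apply eq_zero_of_det_smul_coeffMatrix_eq_zero
  rw [← Matrix.det_transpose, ← one_mul (coeffMatrix α), ← Matrix.smul_mul, ← Matrix.adjugate_mul,
    Matrix.mul_assoc, hXM, Matrix.mul_zero]

/-- **Right one-sided syzygies vanish**: `Σ_q α_q(B)·(AB)_q ≡ 0` with `α_q ∈ ℂ[B]` forces `α = 0`. -/
theorem eq_zero_of_right_syzygy {α : OneSided n} (h : ∀ A B, rightSyzEval α A B = 0) : α = 0 := by
  classical
  -- `M · Xᵀ = 0` over `ℂ[X]`
  have hMX : coeffMatrix α * (Matrix.mvPolynomialX (Fin n) (Fin n) ℂ).transpose = 0 := by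
    refine Matrix.ext fun q₁ k => ?_
    apply MvPolynomial.funext
    intro B
    simp only [Matrix.mul_apply, Matrix.transpose_apply, Matrix.mvPolynomialX_apply, coeffMatrix,
      Matrix.of_apply, Matrix.zero_apply, map_sum, map_mul, eval_X, map_zero]
    simpa using right_row_identity h B q₁ k
  apply eq_zero_of_det_smul_coeffMatrix_eq_zero
  rw [← Matrix.det_transpose, ← mul_one (coeffMatrix α), ← Matrix.mul_smul, ← Matrix.mul_adjugate,
    ← Matrix.mul_assoc, hMX, Matrix.zero_mul]

/-! ## Bridge to `ℂ[A,B,C]` -/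

/-- `α_q ∈ ℂ[A] ⊂ ℂ[A,B,C]`. -/
def leftPoly (α : OneSided n) (q : Fin n × Fin n) : MvPolynomial (GraphVars n) ℂ :=
  rename (fun v => (Sum.inl (Sum.inl v) : GraphVars n)) (α q)

/-- `α_q ∈ ℂ[B] ⊂ ℂ[A,B,C]`. -/
def rightPoly (α : OneSided n) (q : Fin n × Fin n) : MvPolynomial (GraphVars n) ℂ :=
  rename (fun v => (Sum.inl (Sum.inr v) : GraphVars n)) (α q)

/-- `α_q(A, B, 0) = α_q(A)`. -/
theorem eval_abPoint_leftPoly (α : OneSided n) (q : Fin n × Fin n) (A B : Fin n × Fin n → ℂ) :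
    eval (abPoint A B) (leftPoly α q) = eval A (α q) := by
  rw [leftPoly, eval_rename]; rfl

/-- `α_q(A, B, 0) = α_q(B)`. -/
theorem eval_abPoint_rightPoly (α : OneSided n) (q : Fin n × Fin n) (A B : Fin n × Fin n → ℂ) :
    eval (abPoint A B) (rightPoly α q) = eval B (α q) := by
  rw [rightPoly, eval_rename]; rfl

/-- **Bridge, left**: `Σ_q α_q φ_q = 0` in `ℂ[A,B,C]` with `α_q ∈ ℂ[A]` forces `α = 0`. -/
theorem eq_zero_of_leftPoly_syzygy {α : OneSided n}
    (h : ∑ q : Fin n × Fin n, leftPoly α q * phiPoly n q = 0) : α = 0 := by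
  apply eq_zero_of_left_syzygy
  intro A B
  have := congrArg (eval (abPoint A B)) h
  simpa [map_sum, map_mul, eval_abPoint_leftPoly, eval_abPoint_phiPoly, leftSyzEval] using this

/-- **Bridge, right**: `Σ_q α_q φ_q = 0` in `ℂ[A,B,C]` with `α_q ∈ ℂ[B]` forces `α = 0`. -/
theorem eq_zero_of_rightPoly_syzygy {α : OneSided n}
    (h : ∑ q : Fin n × Fin n, rightPoly α q * phiPoly n q = 0) : α = 0 := by
  apply eq_zero_of_right_syzygy
  intro A B
  have := congrArg (eval (abPoint A B)) h
  simpa [map_sum, map_mul, eval_abPoint_rightPoly, eval_abPoint_phiPoly, rightSyzEval] using this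

/-- In particular (`α_q` constants): the `n²` quadrics `φ_q` are linearly independent, and more
generally NO nonzero `ℂ[A]`-combination or `ℂ[B]`-combination of them vanishes — the only syzygies of
`u`-degree `≤ 2` among the `φ_q` mix `A` and `B`, and for `n ≥ 3` those are Koszul
(`isKoszul_of_bilinear_syzygy`). -/
theorem eq_zero_of_const_syzygy {μ : Fin n × Fin n → ℂ}
    (h : ∑ q : Fin n × Fin n, C (μ q) * phiPoly n q = 0) : μ = 0 := by
  have hα : (fun q => C (μ q) : OneSided n) = 0 := by
    apply eq_zero_of_leftPoly_syzygy
    simpa [leftPoly, rename_C] using h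
  funext q
  simpa using congr_fun hα q

end Summit.MatrixMultiplication.MatrixMultiplication.Theorems.GraphEquations

end
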